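import Literature.NumberTheory.Sieve.DrappeauDispersionR1ppBlockBound
import Literature.NumberTheory.Sieve.DrappeauDispersionR1ppNumerics
import HarnessLib

/-!
# Drappeau 2017, §5.5: the four pieces of a block of `ℛ₁''`, bounded ((5.24)–(5.25))

Topic `Literature/NumberTheory/Sieve`, part of the formalisation of §5 of S. Drappeau, Proc. London
Math. Soc. (3) 114 (2017) 684–732 = arXiv:1504.05549, p. 21.  Combining `blk_le_crux_XY_σ`
(Theorem 2.1 applied to a blocked piece) with the exponent bookkeeping `cruxR((Finset.Icc (-(H : ℤ)) H).filter (fun h : ℤ => h ≠ 0))le` and the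
coefficient bound `∑‖b‖² ≤ (#B)²·#{h}·sup‖V‖²` (`sum_norm_bGen_sq_le`): for each sign block and
each pair of divisors, the four pieces together are `≤ 4·169632·A·W·N²S²·x^{−8κ}` with
`W = √(9/5)·B_β²` (`‖β‖_∞ ≤ B_β`).  Everything proved (no definition, no named fact).

* `card_Bset_le`, `card_Hs_le`, `norm_V_le_pos/neg`, `Sb_le_pos/neg` — the coefficient side;
* `four_blocks_le_pos`, `four_blocks_le_neg` — the bound for the four pieces of a block.

## References

* S. Drappeau, Proc. London Math. Soc. (3) 114 (2017) 684–732, arXiv:1504.05549, §5.5 p. 21,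
  (5.24)–(5.25). [cite: Drappeau2017, §5.5]
* E. Assing, V. Blomer, J. Li, Adv. Math. 393 (2021), Theorem 2.3. [cite: AssingBlomerLi2020, Theorem 2.3]
-/

noncomputable section

open Finset Real Complex
open scoped ArithmeticFunction.Moebius FourierTransform

namespace Literature.NumberTheory.Sieve

namespace Drappeau2017

open KloostermanQuintilinear

/-- `#B ≤ 2N + 1`. [folklore] -/
theorem card_Bset_le {N : ℝ} (hN : 0 ≤ N) (a₂ : ℤ) (n₀ : ℕ) :
    ((((((BFI.dyadic N).filter (fun n : ℕ => IsCoprime (n : ℤ) a₂)).filter (fun n : ℕ => n₀ ∣ n)).image (fun n : ℕ => n / n₀))).card : ℝ) ≤ 2 * N + 1 := by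
  have h1 : (((((BFI.dyadic N).filter (fun n : ℕ => IsCoprime (n : ℤ) a₂)).filter (fun n : ℕ => n₀ ∣ n)).image (fun n : ℕ => n / n₀))).card ≤ (BFI.dyadic N).card :=
    Finset.card_image_le.trans ((Finset.card_filter_le _ _).trans (Finset.card_filter_le _ _))
  have h2 : (BFI.dyadic N).card ≤ ⌊2 * N⌋₊ + 1 := by
    unfold BFI.dyadic
    exact (Finset.card_filter_le _ _).trans (by rw [Finset.card_range])
  have h3 : (((((((BFI.dyadic N).filter (fun n : ℕ => IsCoprime (n : ℤ) a₂)).filter (fun n : ℕ => n₀ ∣ n)).image (fun n : ℕ => n / n₀))).card : ℕ) : ℝ) ≤ ((⌊2 * N⌋₊ + 1 : ℕ) : ℝ) := by exact_mod_cast h1.trans h2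
  push_cast at h3
  linarith [Nat.floor_le (by linarith : 0 ≤ 2 * N)]

/-- `#{h : 0 < |h| ≤ H} ≤ 2H`. [folklore] -/
theorem card_Hs_le (H : ℕ) : ((((Finset.Icc (-(H : ℤ)) H).filter (fun h : ℤ => h ≠ 0)).card : ℕ) : ℝ) ≤ 2 * H := by
  have h1 : ((Finset.Icc (-(H : ℤ)) H).filter (fun h : ℤ => h ≠ 0)).card + 1 = (Finset.Icc (-(H : ℤ)) H).card := by
    have h0 : (0 : ℤ) ∈ Finset.Icc (-(H : ℤ)) H := by simp
    rw [Finset.filter_ne' _ _, Finset.card_erase_add_one h0]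
  rw [Int.card_Icc] at h1
  have h2 : ((H : ℤ) + 1 - -(H : ℤ)).toNat = 2 * H + 1 := by omega
  rw [h2] at h1
  have : ((Finset.Icc (-(H : ℤ)) H).filter (fun h : ℤ => h ≠ 0)).card = 2 * H := by omega
  rw [this]; push_cast; exact le_rfl

section V

variable {a₁ a₂ : ℤ} {q₀ n₀ l₁ l₂ : ℕ} {β : ℕ → ℂ} {ξ : ℝ} {Bβ : ℝ}

/-- `|V| ≤ B_β²` for the value of (5.23). [folklore] -/
theorem norm_V_le_pos (hB0 : 0 ≤ Bβ) (hβb : ∀ n, ‖β n‖ ≤ Bβ) (h : ℤ) (n₁ n₂ : ℕ) :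
    ‖(fun h n₁ n₂ => (β (n₀ * n₁) * starRingEnd ℂ (β (n₀ * n₂)) *
              ((𝐞 (-(ξ * h)) : ℂ) *
                (𝐞 (-((h : ℝ) * a₁ *
                    ((((((q₀ : ℤ) * l₁ * l₂ * n₁ : ℤ) : ZMod (a₂.natAbs * n₀))⁻¹).val : ℕ) : ℝ) /
                      ((a₂ : ℝ) * n₀))) : ℂ)))) h n₁ n₂‖ ≤ Bβ ^ 2 := by
  beta_reduce
  rw [norm_mul, norm_mul, norm_mul, Circle.norm_coe, Circle.norm_coe, Complex.norm_conj, mul_one,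
    mul_one, sq]
  exact mul_le_mul (hβb _) (hβb _) (norm_nonneg _) hB0

/-- `|conj V| ≤ B_β²`. [folklore] -/
theorem norm_V_le_neg (hB0 : 0 ≤ Bβ) (hβb : ∀ n, ‖β n‖ ≤ Bβ) (h : ℤ) (n₁ n₂ : ℕ) :
    ‖(fun h n₁ n₂ => starRingEnd ℂ (β (n₀ * n₁) * starRingEnd ℂ (β (n₀ * n₂)) *
              ((𝐞 (-(ξ * h)) : ℂ) *
                (𝐞 (-((h : ℝ) * a₁ *
                    ((((((q₀ : ℤ) * l₁ * l₂ * n₁ : ℤ) : ZMod (a₂.natAbs * n₀))⁻¹).val : ℕ) : ℝ) /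
                      ((a₂ : ℝ) * n₀))) : ℂ)))) h n₁ n₂‖ ≤ Bβ ^ 2 := by
  beta_reduce
  rw [Complex.norm_conj]
  exact norm_V_le_pos hB0 hβb h n₁ n₂

end V

section Sb

variable {N : ℝ} {a₁ a₂ : ℤ} {q₀ n₀ l₁ l₂ δ₁ δ₂ : ℕ} {β : ℕ → ℂ} {ξ : ℝ} {Bβ : ℝ}

/-- **`∑‖b‖² ≤ 10 N² (H+1) W²`** with `W = √(9/5) B_β²` (positive block). [cite: Drappeau2017, §5.5 p. 21] -/
theorem Sb_le_pos (hN : 1 ≤ N) (ha₂ : a₂ ≠ 0) (hn₀ : 0 < n₀) (hδ₁ : 0 < δ₁) (hδ₂ : 0 < δ₂)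
    (hB0 : 0 ≤ Bβ) (hβb : ∀ n, ‖β n‖ ≤ Bβ) (H k : ℕ) :
    (∑ n ∈ Finset.Icc 1 ⌊((2 ^ (k + 1) : ℕ) : ℝ)⌋₊, ∑ r ∈ Finset.Icc 1 ⌊2 * ((a₂.natAbs : ℝ) * δ₁ * N)⌋₊, ∑ s ∈ Finset.Icc 1 ⌊2 * ((δ₂ : ℝ) * N / n₀)⌋₊, ‖(bCoef a₁ a₂ ((((BFI.dyadic N).filter (fun n : ℕ => IsCoprime (n : ℤ) a₂)).filter (fun n : ℕ => n₀ ∣ n)).image (fun n : ℕ => n / n₀)) q₀ n₀ l₁ l₂ β ξ H 1 (2 ^ k) (2 ^ (k + 1)) δ₁ δ₂) n r s‖ ^ 2) ≤ 10 * N ^ 2 * ((H : ℝ) + 1) * (Real.sqrt (9 / 5) * Bβ ^ 2) ^ 2 := by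
  simp only [bCoef_eq_bGen]
  have h1 := sum_norm_bGen_sq_le (a₁ := a₁) (q₀ := q₀) (σ := 1) (nhi := 2 ^ (k + 1)) ha₂ hn₀ hδ₁ hδ₂
    (Nat.one_le_two_pow (n := k)) ((((BFI.dyadic N).filter (fun n : ℕ => IsCoprime (n : ℤ) a₂)).filter (fun n : ℕ => n₀ ∣ n)).image (fun n : ℕ => n / n₀)) H (fun h n₁ n₂ => (β (n₀ * n₁) * starRingEnd ℂ (β (n₀ * n₂)) *
              ((𝐞 (-(ξ * h)) : ℂ) *
                (𝐞 (-((h : ℝ) * a₁ *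
                    ((((((q₀ : ℤ) * l₁ * l₂ * n₁ : ℤ) : ZMod (a₂.natAbs * n₀))⁻¹).val : ℕ) : ℝ) /
                      ((a₂ : ℝ) * n₀))) : ℂ)))) (by positivity) (norm_V_le_pos hB0 hβb)
    (Finset.Icc 1 ⌊((2 ^ (k + 1) : ℕ) : ℝ)⌋₊) (Finset.Icc 1 ⌊2 * ((a₂.natAbs : ℝ) * δ₁ * N)⌋₊) (Finset.Icc 1 ⌊2 * ((δ₂ : ℝ) * N / n₀)⌋₊)
  refine h1.trans ?_
  have hB := card_Bset_le (by linarith : (0 : ℝ) ≤ N) a₂ n₀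
  have hH := card_Hs_le H
  have hW2 : (Real.sqrt (9 / 5) * Bβ ^ 2) ^ 2 = 9 / 5 * Bβ ^ 4 := by
    rw [mul_pow, Real.sq_sqrt (by norm_num)]; ring
  rw [hW2]
  have hc0 : (0 : ℝ) ≤ ((((((BFI.dyadic N).filter (fun n : ℕ => IsCoprime (n : ℤ) a₂)).filter (fun n : ℕ => n₀ ∣ n)).image (fun n : ℕ => n / n₀))).card : ℝ) := by positivity
  have hB2 : ((((((BFI.dyadic N).filter (fun n : ℕ => IsCoprime (n : ℤ) a₂)).filter (fun n : ℕ => n₀ ∣ n)).image (fun n : ℕ => n / n₀))).card : ℝ) ^ 2 ≤ 9 * N ^ 2 := by nlinarith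
  have hB4 : 0 ≤ Bβ ^ 2 := sq_nonneg _
  calc ((((((BFI.dyadic N).filter (fun n : ℕ => IsCoprime (n : ℤ) a₂)).filter (fun n : ℕ => n₀ ∣ n)).image (fun n : ℕ => n / n₀))).card : ℝ) ^ 2 * ((((Finset.Icc (-(H : ℤ)) H).filter (fun h : ℤ => h ≠ 0)).card : ℕ) : ℝ) * (Bβ ^ 2) ^ 2
      ≤ (9 * N ^ 2) * (2 * H) * (Bβ ^ 2) ^ 2 := by gcongr
    _ ≤ 10 * N ^ 2 * ((H : ℝ) + 1) * (9 / 5 * Bβ ^ 4) := by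
        have : (0 : ℝ) ≤ N ^ 2 * (Bβ ^ 2) ^ 2 := by positivity
        nlinarith

/-- **`∑‖b‖² ≤ 10 N² (H+1) W²`** (negative block, conjugate value). [cite: Drappeau2017, §5.5 p. 21] -/
theorem Sb_le_neg (hN : 1 ≤ N) (ha₂ : a₂ ≠ 0) (hn₀ : 0 < n₀) (hδ₁ : 0 < δ₁) (hδ₂ : 0 < δ₂)
    (hB0 : 0 ≤ Bβ) (hβb : ∀ n, ‖β n‖ ≤ Bβ) (H k : ℕ) :
    (∑ n ∈ Finset.Icc 1 ⌊((2 ^ (k + 1) : ℕ) : ℝ)⌋₊, ∑ r ∈ Finset.Icc 1 ⌊2 * ((a₂.natAbs : ℝ) * δ₁ * N)⌋₊, ∑ s ∈ Finset.Icc 1 ⌊2 * ((δ₂ : ℝ) * N / n₀)⌋₊, ‖(bGen a₁ a₂ ((((BFI.dyadic N).filter (fun n : ℕ => IsCoprime (n : ℤ) a₂)).filter (fun n : ℕ => n₀ ∣ n)).image (fun n : ℕ => n / n₀)) q₀ n₀ H (-1) (2 ^ k) (2 ^ (k + 1)) δ₁ δ₂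
            (fun h n₁ n₂ => starRingEnd ℂ (β (n₀ * n₁) * starRingEnd ℂ (β (n₀ * n₂)) *
              ((𝐞 (-(ξ * h)) : ℂ) *
                (𝐞 (-((h : ℝ) * a₁ *
                    ((((((q₀ : ℤ) * l₁ * l₂ * n₁ : ℤ) : ZMod (a₂.natAbs * n₀))⁻¹).val : ℕ) : ℝ) /
                      ((a₂ : ℝ) * n₀))) : ℂ))))) n r s‖ ^ 2) ≤ 10 * N ^ 2 * ((H : ℝ) + 1) * (Real.sqrt (9 / 5) * Bβ ^ 2) ^ 2 := by
  have h1 := sum_norm_bGen_sq_le (a₁ := a₁) (q₀ := q₀) (σ := -1) (nhi := 2 ^ (k + 1)) ha₂ hn₀ hδ₁ hδ₂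
    (Nat.one_le_two_pow (n := k)) ((((BFI.dyadic N).filter (fun n : ℕ => IsCoprime (n : ℤ) a₂)).filter (fun n : ℕ => n₀ ∣ n)).image (fun n : ℕ => n / n₀)) H (fun h n₁ n₂ => starRingEnd ℂ (β (n₀ * n₁) * starRingEnd ℂ (β (n₀ * n₂)) *
              ((𝐞 (-(ξ * h)) : ℂ) *
                (𝐞 (-((h : ℝ) * a₁ *
                    ((((((q₀ : ℤ) * l₁ * l₂ * n₁ : ℤ) : ZMod (a₂.natAbs * n₀))⁻¹).val : ℕ) : ℝ) /
                      ((a₂ : ℝ) * n₀))) : ℂ)))) (by positivity) (norm_V_le_neg hB0 hβb)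
    (Finset.Icc 1 ⌊((2 ^ (k + 1) : ℕ) : ℝ)⌋₊) (Finset.Icc 1 ⌊2 * ((a₂.natAbs : ℝ) * δ₁ * N)⌋₊) (Finset.Icc 1 ⌊2 * ((δ₂ : ℝ) * N / n₀)⌋₊)
  refine h1.trans ?_
  have hB := card_Bset_le (by linarith : (0 : ℝ) ≤ N) a₂ n₀
  have hH := card_Hs_le H
  have hW2 : (Real.sqrt (9 / 5) * Bβ ^ 2) ^ 2 = 9 / 5 * Bβ ^ 4 := by
    rw [mul_pow, Real.sq_sqrt (by norm_num)]; ring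
  rw [hW2]
  have hc0 : (0 : ℝ) ≤ ((((((BFI.dyadic N).filter (fun n : ℕ => IsCoprime (n : ℤ) a₂)).filter (fun n : ℕ => n₀ ∣ n)).image (fun n : ℕ => n / n₀))).card : ℝ) := by positivity
  have hB2 : ((((((BFI.dyadic N).filter (fun n : ℕ => IsCoprime (n : ℤ) a₂)).filter (fun n : ℕ => n₀ ∣ n)).image (fun n : ℕ => n / n₀))).card : ℝ) ^ 2 ≤ 9 * N ^ 2 := by nlinarith
  have hB4 : 0 ≤ Bβ ^ 2 := sq_nonneg _
  calc ((((((BFI.dyadic N).filter (fun n : ℕ => IsCoprime (n : ℤ) a₂)).filter (fun n : ℕ => n₀ ∣ n)).image (fun n : ℕ => n / n₀))).card : ℝ) ^ 2 * ((((Finset.Icc (-(H : ℤ)) H).filter (fun h : ℤ => h ≠ 0)).card : ℕ) : ℝ) * (Bβ ^ 2) ^ 2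
      ≤ (9 * N ^ 2) * (2 * H) * (Bβ ^ 2) ^ 2 := by gcongr
    _ ≤ 10 * N ^ 2 * ((H : ℝ) + 1) * (9 / 5 * Bβ ^ 4) := by
        have : (0 : ℝ) ≤ N ^ 2 * (Bβ ^ 2) ^ 2 := by positivity
        nlinarith

end Sb

set_option maxHeartbeats 1000000 in
/-- **The four pieces of a positive block of `ℛ₁''` are `≤ 4·169632·A·W·N²S²·x^{−8κ}`.**
[cite: Drappeau2017, §5.5 p. 21, (5.24)–(5.25)] -/
theorem four_blocks_le_pos {x η δ κ ε₁ e θ : ℝ} (hx : 1 ≤ x) (hη : 0 < η) (hη' : η ≤ 1 / 9)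
    (hδ : 0 ≤ δ) (hκ : 0 ≤ κ) (hε₁ : 0 ≤ ε₁) (he : 0 ≤ e) (he1 : e ≤ 1) (hθ : θ = δ + κ)
    (hδs : δ ≤ 1 / 100) (hκs : κ ≤ 1 / 100) (hε₁s : ε₁ ≤ 1 / 100)
    (hexp : 7 / 2 * e + 15 / 2 * δ + 21 / 2 * κ + ε₁ ≤ min (3 * η / 4) (1 / 6) / 2)
    {S Y N M ξ : ℝ} (hSx : x ^ (1 / 4 : ℝ) ≤ S) (hSx' : S ≤ x ^ (1 / 2 + δ)) (hN1 : 1 ≤ N)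
    (hNS : N ≤ S ^ (2 / 3 - η)) (hY : 0 < Y) (hYS : Y ≤ S / 4) (hM : 0 ≤ M) (hξ : 0 ≤ ξ)
    {a₁ a₂ : ℤ} (ha₂ : a₂ ≠ 0) {q₀ n₀ : ℕ} (hq₀ : 0 < q₀) (hn₀ : 0 < n₀)
    (hq₀n₀ : Nat.Coprime q₀ n₀) (hq₀a₂ : IsCoprime (q₀ : ℤ) a₂)
    {l₁ l₂ : ℕ} (hl₁ : Nat.Coprime l₁ (a₂.natAbs * n₀)) (hl₂ : Nat.Coprime l₂ (a₂.natAbs * n₀))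
    (hl₁lt : l₁ < a₂.natAbs * n₀) (hl₂lt : l₂ < a₂.natAbs * n₀)
    {δ₁ δ₂ : ℕ} (hδ₁ : 0 < δ₁) (hδ₂ : 0 < δ₂) (hδ₁m : Nat.Coprime δ₁ (a₂.natAbs * n₀))
    (hδ₂m : Nat.Coprime δ₂ (a₂.natAbs * n₀))
    (hδ₁x : (δ₁ : ℝ) ≤ x ^ δ) (hδ₂x : (δ₂ : ℝ) ≤ x ^ δ) (ha₂x : (a₂.natAbs : ℝ) ≤ x ^ δ)
    (hq : ((a₂.natAbs * n₀ : ℕ) : ℝ) ≤ x ^ θ) (hn₀N : (n₀ : ℝ) ≤ N)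
    {β : ℕ → ℂ} (hβ : ∀ n, ¬Squarefree n → β n = 0) {Bβ : ℝ} (hB0 : 0 ≤ Bβ)
    (hβb : ∀ n, ‖β n‖ ≤ Bβ) (H k : ℕ) (hHr : (H : ℝ) ≤ 9 * S ^ 2 * N * x ^ ε₁ / x + 1)
    (hk : ((2 ^ (k + 1) : ℕ) : ℝ) ≤ 4 * x ^ δ * H * N + 2)
    (hC1 : (1 : ℝ) ≤ 29 / 40 * S / ((q₀ : ℝ) * δ₂)) (hD1 : (1 : ℝ) ≤ 29 / 40 * S / ((q₀ : ℝ) * δ₁))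
    {ε₀ Λ : ℝ} (hε₀ : 0 ≤ ε₀) (hε₀1 : ε₀ ≤ 1) (hΛ : 0 ≤ Λ)
    (hΛt : ∀ t : ℝ, (S - Y) / ((q₀ : ℝ) * ((δ₁ : ℝ) * δ₂)) ≤ t →
      (2 * S + Y) / Y + 29 + 3 ≤ Λ * t ^ ε₀)
    {A : ℝ} (hA : 0 ≤ A)
    (hcrux : (∀ C D N R S : ℝ, 1 ≤ C → 1 ≤ D → 1 ≤ N → 1 ≤ R → 1 ≤ S →
      ∀ q c₀ d₀ : ℕ, 0 < q → Nat.Coprime (c₀ * d₀) q →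
      ∀ b : ℕ → ℕ → ℕ → ℂ,
        (∀ n r s : ℕ, b n r s ≠ 0 →
          (0 < n ∧ (n : ℝ) ≤ N ∧ R < r ∧ (r : ℝ) ≤ 2 * R ∧ S < s ∧ (s : ℝ) ≤ 2 * S)) →
      ∀ g : ℝ → ℝ → ℝ → ℝ → ℝ → ℂ,
        ContDiff ℝ (⊤ : ℕ∞) (fun p : Fin 5 → ℝ => g (p 0) (p 1) (p 2) (p 3) (p 4)) →
        HasCompactSupport (fun p : Fin 5 → ℝ => g (p 0) (p 1) (p 2) (p 3) (p 4)) →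
        (∀ c d n r s : ℝ, g c d n r s ≠ 0 →
          (C < c ∧ c ≤ 2 * C ∧ D < d ∧ d ≤ 2 * D ∧ 0 < n ∧ 0 < r ∧ 0 < s)) →
        (∀ ν : Fin 5 → ℕ, ∀ c d n r s : ℝ, 0 < c → 0 < d → 0 < n → 0 < r → 0 < s →
          ‖mixedDeriv ν g c d n r s‖ ≤ KnuFamily Λ ν *
            (c ^ (-(ν 0 : ℝ)) * d ^ (-(ν 1 : ℝ)) * n ^ (-(ν 2 : ℝ)) * r ^ (-(ν 3 : ℝ)) *
              s ^ (-(ν 4 : ℝ))) ^ (1 - ε₀)) →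
        ‖∑ c ∈ Finset.Icc 1 ⌊2 * C⌋₊, ∑ d ∈ Finset.Icc 1 ⌊2 * D⌋₊, ∑ n ∈ Finset.Icc 1 ⌊N⌋₊, ∑ r ∈ Finset.Icc 1 ⌊2 * R⌋₊,
            ∑ s ∈ Finset.Icc 1 ⌊2 * S⌋₊,
            (if (c ≡ c₀ [MOD q] ∧ d ≡ d₀ [MOD q] ∧ Nat.Coprime (q * r * d) (s * c)) then
              b n r s * g c d n r s *
                (𝐞 ((n : ℝ) * ((((r * d : ℕ) : ZMod (s * c))⁻¹).val : ℝ) / ((s : ℝ) * c)) : ℂ)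
            else 0)‖ ≤
          A * ((q : ℝ) * C * D * N * R * S) ^ e * (q : ℝ) ^ (3 / 2 : ℝ) *
            Real.sqrt
              ((q : ℝ) ^ 2 * (C * S * (R * S + N) * (C + R * D) + S * N * R) *
                  (∑ n ∈ Finset.Icc 1 ⌊N⌋₊, ∑ r ∈ Finset.Icc 1 ⌊2 * R⌋₊, ∑ s ∈ Finset.Icc 1 ⌊2 * S⌋₊, ‖b n r s‖ ^ 2) +
                (q : ℝ) * (C ^ 2 * D * S * Real.sqrt (R * (R * S + N)) + D ^ 2 * N * R) *
                  (∑ n ∈ Finset.Icc 1 ⌊N⌋₊, ∑ r ∈ Finset.Icc 1 ⌊2 * R⌋₊, ∑ s ∈ Finset.Icc 1 ⌊2 * S⌋₊, ‖b n r s‖ ^ 2)))) :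
    ‖pieceSumBlk a₁ a₂ (((((((BFI.mRange S Y).filter (fun q : ℕ => 0 < q)).filter (fun q : ℕ => IsCoprime (q : ℤ) a₂)).filter (fun q : ℕ => q₀ ∣ q)).image (fun q : ℕ => q / q₀)).filter (fun q : ℕ => q % (a₂.natAbs * n₀) = l₁)).filter (fun q : ℕ => δ₁ ∣ q))
        (((((((BFI.mRange S Y).filter (fun q : ℕ => 0 < q)).filter (fun q : ℕ => IsCoprime (q : ℤ) a₂)).filter (fun q : ℕ => q₀ ∣ q)).image (fun q : ℕ => q / q₀)).filter (fun q : ℕ => q % (a₂.natAbs * n₀) = l₂)).filter (fun q : ℕ => δ₂ ∣ q)) ((((BFI.dyadic N).filter (fun n : ℕ => IsCoprime (n : ℤ) a₂)).filter (fun n : ℕ => n₀ ∣ n)).image (fun n : ℕ => n / n₀))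
        q₀ n₀ l₁ l₂ β ξ (fun q₁ q₂ : ℕ => pieceLo S Y q₀ q₁ * pieceLo S Y q₀ q₂ *
          alphaProfile ((q₀ : ℝ) * ξ / M * q₁ * q₂)) H 1 (2 ^ k) (2 ^ (k + 1))‖ +
      ‖pieceSumBlk a₁ a₂ (((((((BFI.mRange S Y).filter (fun q : ℕ => 0 < q)).filter (fun q : ℕ => IsCoprime (q : ℤ) a₂)).filter (fun q : ℕ => q₀ ∣ q)).image (fun q : ℕ => q / q₀)).filter (fun q : ℕ => q % (a₂.natAbs * n₀) = l₁)).filter (fun q : ℕ => δ₁ ∣ q))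
        (((((((BFI.mRange S Y).filter (fun q : ℕ => 0 < q)).filter (fun q : ℕ => IsCoprime (q : ℤ) a₂)).filter (fun q : ℕ => q₀ ∣ q)).image (fun q : ℕ => q / q₀)).filter (fun q : ℕ => q % (a₂.natAbs * n₀) = l₂)).filter (fun q : ℕ => δ₂ ∣ q)) ((((BFI.dyadic N).filter (fun n : ℕ => IsCoprime (n : ℤ) a₂)).filter (fun n : ℕ => n₀ ∣ n)).image (fun n : ℕ => n / n₀))
        q₀ n₀ l₁ l₂ β ξ (fun q₁ q₂ : ℕ => pieceLo S Y q₀ q₁ * pieceHi S Y q₀ q₂ *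
          alphaProfile ((q₀ : ℝ) * ξ / M * q₁ * q₂)) H 1 (2 ^ k) (2 ^ (k + 1))‖ +
      ‖pieceSumBlk a₁ a₂ (((((((BFI.mRange S Y).filter (fun q : ℕ => 0 < q)).filter (fun q : ℕ => IsCoprime (q : ℤ) a₂)).filter (fun q : ℕ => q₀ ∣ q)).image (fun q : ℕ => q / q₀)).filter (fun q : ℕ => q % (a₂.natAbs * n₀) = l₁)).filter (fun q : ℕ => δ₁ ∣ q))
        (((((((BFI.mRange S Y).filter (fun q : ℕ => 0 < q)).filter (fun q : ℕ => IsCoprime (q : ℤ) a₂)).filter (fun q : ℕ => q₀ ∣ q)).image (fun q : ℕ => q / q₀)).filter (fun q : ℕ => q % (a₂.natAbs * n₀) = l₂)).filter (fun q : ℕ => δ₂ ∣ q)) ((((BFI.dyadic N).filter (fun n : ℕ => IsCoprime (n : ℤ) a₂)).filter (fun n : ℕ => n₀ ∣ n)).image (fun n : ℕ => n / n₀))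
        q₀ n₀ l₁ l₂ β ξ (fun q₁ q₂ : ℕ => pieceHi S Y q₀ q₁ * pieceLo S Y q₀ q₂ *
          alphaProfile ((q₀ : ℝ) * ξ / M * q₁ * q₂)) H 1 (2 ^ k) (2 ^ (k + 1))‖ +
      ‖pieceSumBlk a₁ a₂ (((((((BFI.mRange S Y).filter (fun q : ℕ => 0 < q)).filter (fun q : ℕ => IsCoprime (q : ℤ) a₂)).filter (fun q : ℕ => q₀ ∣ q)).image (fun q : ℕ => q / q₀)).filter (fun q : ℕ => q % (a₂.natAbs * n₀) = l₁)).filter (fun q : ℕ => δ₁ ∣ q))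
        (((((((BFI.mRange S Y).filter (fun q : ℕ => 0 < q)).filter (fun q : ℕ => IsCoprime (q : ℤ) a₂)).filter (fun q : ℕ => q₀ ∣ q)).image (fun q : ℕ => q / q₀)).filter (fun q : ℕ => q % (a₂.natAbs * n₀) = l₂)).filter (fun q : ℕ => δ₂ ∣ q)) ((((BFI.dyadic N).filter (fun n : ℕ => IsCoprime (n : ℤ) a₂)).filter (fun n : ℕ => n₀ ∣ n)).image (fun n : ℕ => n / n₀))
        q₀ n₀ l₁ l₂ β ξ (fun q₁ q₂ : ℕ => pieceHi S Y q₀ q₁ * pieceHi S Y q₀ q₂ *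
          alphaProfile ((q₀ : ℝ) * ξ / M * q₁ * q₂)) H 1 (2 ^ k) (2 ^ (k + 1))‖ ≤
      4 * (169632 * A * (Real.sqrt (9 / 5) * Bβ ^ 2) * N ^ 2 * S ^ 2 * x ^ (-8 * κ)) := by
  have hx0 : 0 < x := by linarith
  have hN : 0 < N := by linarith
  have hS : 0 < S := by linarith
  have hq₀r : (0 : ℝ) < q₀ := by exact_mod_cast hq₀
  have hn₀r : (0 : ℝ) < n₀ := by exact_mod_cast hn₀
  have hδ₁r : (0 : ℝ) < δ₁ := by exact_mod_cast hδ₁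
  have hδ₂r : (0 : ℝ) < δ₂ := by exact_mod_cast hδ₂
  have har : (0 : ℝ) < a₂.natAbs := by exact_mod_cast Int.natAbs_pos.2 ha₂
  have hm : 0 < a₂.natAbs * n₀ := Nat.mul_pos (Int.natAbs_pos.2 ha₂) hn₀
  -- the numerical hypotheses of `cruxRHS_le`
  have hq1 : (1 : ℝ) ≤ ((a₂.natAbs * n₀ : ℕ) : ℝ) := by exact_mod_cast hm
  have hq₀δ₂ : (1 : ℝ) ≤ (q₀ : ℝ) * δ₂ := by
    have : (1 : ℕ) ≤ q₀ * δ₂ := Nat.mul_pos hq₀ hδ₂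
    exact_mod_cast this
  have hq₀δ₁ : (1 : ℝ) ≤ (q₀ : ℝ) * δ₁ := by
    have : (1 : ℕ) ≤ q₀ * δ₁ := Nat.mul_pos hq₀ hδ₁
    exact_mod_cast this
  have hCle : ∀ (cst : ℝ) (u : ℝ), 0 ≤ cst → cst ≤ 2 → 1 ≤ u → cst * S / u ≤ 2 * S := by
    intro cst u h0 h2 hu
    rw [div_le_iff₀ (by linarith)]
    nlinarith [hS.le]
  have hCLo2 : 29 / 40 * S / ((q₀ : ℝ) * δ₂) ≤ 2 * S := hCle _ _ (by norm_num) (by norm_num) hq₀δ₂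
  have hCHi2 : 9 / 8 * S / ((q₀ : ℝ) * δ₂) ≤ 2 * S := hCle _ _ (by norm_num) (by norm_num) hq₀δ₂
  have hDLo2 : 29 / 40 * S / ((q₀ : ℝ) * δ₁) ≤ 2 * S := hCle _ _ (by norm_num) (by norm_num) hq₀δ₁
  have hDHi2 : 9 / 8 * S / ((q₀ : ℝ) * δ₁) ≤ 2 * S := hCle _ _ (by norm_num) (by norm_num) hq₀δ₁
  have hC1' : (1 : ℝ) ≤ 9 / 8 * S / ((q₀ : ℝ) * δ₂) :=
    hC1.trans (by rw [div_le_div_iff_of_pos_right (by positivity)]; nlinarith [hS.le])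
  have hD1' : (1 : ℝ) ≤ 9 / 8 * S / ((q₀ : ℝ) * δ₁) :=
    hD1.trans (by rw [div_le_div_iff_of_pos_right (by positivity)]; nlinarith [hS.le])
  have hR1 : (1 : ℝ) ≤ (a₂.natAbs : ℝ) * δ₁ * N := by
    have h1 : (1 : ℝ) ≤ (a₂.natAbs : ℝ) := by exact_mod_cast Int.natAbs_pos.2 ha₂
    have h2 : (1 : ℝ) ≤ (δ₁ : ℝ) := by exact_mod_cast hδ₁
    nlinarith [mul_nonneg (sub_nonneg.2 h1) (sub_nonneg.2 h2), mul_nonneg (mul_nonneg har.le hδ₁r.le) (sub_nonneg.2 hN1)]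
  have hS1 : (1 : ℝ) ≤ (δ₂ : ℝ) * N / n₀ := by
    rw [le_div_iff₀ hn₀r]
    have h2 : (1 : ℝ) ≤ (δ₂ : ℝ) := by exact_mod_cast hδ₂
    nlinarith
  have hRx : (a₂.natAbs : ℝ) * δ₁ * N ≤ x ^ (2 * δ) * N := by
    have : x ^ (2 * δ) = x ^ δ * x ^ δ := by rw [← Real.rpow_add hx0]; ring_nf
    rw [this]; gcongr
  have hSx1 : (δ₂ : ℝ) * N / n₀ ≤ x ^ δ * N := by
    rw [div_le_iff₀ hn₀r]
    have h1 : (1 : ℝ) ≤ n₀ := by exact_mod_cast hn₀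
    have h2 : (δ₂ : ℝ) * N ≤ x ^ δ * N := by gcongr
    nlinarith [mul_nonneg (Real.rpow_nonneg hx0.le δ) hN.le]
  have hSb := Sb_le_pos (a₁ := a₁) (l₁ := l₁) (l₂ := l₂) (ξ := ξ) (q₀ := q₀) hN1 ha₂ hn₀ hδ₁ hδ₂ hB0 hβb H k
  have hW0 : 0 ≤ Real.sqrt (9 / 5) * Bβ ^ 2 := by positivity
  have hNb0 : (0 : ℝ) ≤ ((2 ^ (k + 1) : ℕ) : ℝ) := by positivity
  -- the four pieces
  have eLL := (blk_le_crux_LL_pos hY hYS hN hM hξ ha₂ hq₀ hn₀ hq₀n₀ hq₀a₂ hl₁ hl₂ hl₁lt hl₂lt hδ₁ hδ₂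
    hδ₁m hδ₂m hβ H k hC1 hD1 hR1 hS1 hε₀ hε₀1 hΛ hΛt hcrux).trans
    (cruxRHS_le hx hη hη' hδ hκ hε₁ he he1 hθ hδs hκs hε₁s hexp hSx hSx' hN1 hNS hHr hq1 hq
      (by positivity) hCLo2 (by positivity) hDLo2 hNb0 hk (by positivity) hRx (by positivity) hSx1
      (by positivity) hSb hW0 hA)
  have eLH := (blk_le_crux_LH_pos hY hYS hN hM hξ ha₂ hq₀ hn₀ hq₀n₀ hq₀a₂ hl₁ hl₂ hl₁lt hl₂lt hδ₁ hδ₂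
    hδ₁m hδ₂m hβ H k hC1' hD1 hR1 hS1 hε₀ hε₀1 hΛ hΛt hcrux).trans
    (cruxRHS_le hx hη hη' hδ hκ hε₁ he he1 hθ hδs hκs hε₁s hexp hSx hSx' hN1 hNS hHr hq1 hq
      (by positivity) hCHi2 (by positivity) hDLo2 hNb0 hk (by positivity) hRx (by positivity) hSx1
      (by positivity) hSb hW0 hA)
  have eHL := (blk_le_crux_HL_pos hY hYS hN hM hξ ha₂ hq₀ hn₀ hq₀n₀ hq₀a₂ hl₁ hl₂ hl₁lt hl₂lt hδ₁ hδ₂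
    hδ₁m hδ₂m hβ H k hC1 hD1' hR1 hS1 hε₀ hε₀1 hΛ hΛt hcrux).trans
    (cruxRHS_le hx hη hη' hδ hκ hε₁ he he1 hθ hδs hκs hε₁s hexp hSx hSx' hN1 hNS hHr hq1 hq
      (by positivity) hCLo2 (by positivity) hDHi2 hNb0 hk (by positivity) hRx (by positivity) hSx1
      (by positivity) hSb hW0 hA)
  have eHH := (blk_le_crux_HH_pos hY hYS hN hM hξ ha₂ hq₀ hn₀ hq₀n₀ hq₀a₂ hl₁ hl₂ hl₁lt hl₂lt hδ₁ hδ₂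
    hδ₁m hδ₂m hβ H k hC1' hD1' hR1 hS1 hε₀ hε₀1 hΛ hΛt hcrux).trans
    (cruxRHS_le hx hη hη' hδ hκ hε₁ he he1 hθ hδs hκs hε₁s hexp hSx hSx' hN1 hNS hHr hq1 hq
      (by positivity) hCHi2 (by positivity) hDHi2 hNb0 hk (by positivity) hRx (by positivity) hSx1
      (by positivity) hSb hW0 hA)
  have hsum := add_le_add (add_le_add (add_le_add eLL eLH) eHL) eHH
  linarith only [hsum]

set_option maxHeartbeats 1000000 in
/-- **The four pieces of a negative block of `ℛ₁''` are `≤ 4·169632·A·W·N²S²·x^{−8κ}`.**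
[cite: Drappeau2017, §5.5 p. 21, (5.24)–(5.25)] -/
theorem four_blocks_le_neg {x η δ κ ε₁ e θ : ℝ} (hx : 1 ≤ x) (hη : 0 < η) (hη' : η ≤ 1 / 9)
    (hδ : 0 ≤ δ) (hκ : 0 ≤ κ) (hε₁ : 0 ≤ ε₁) (he : 0 ≤ e) (he1 : e ≤ 1) (hθ : θ = δ + κ)
    (hδs : δ ≤ 1 / 100) (hκs : κ ≤ 1 / 100) (hε₁s : ε₁ ≤ 1 / 100)
    (hexp : 7 / 2 * e + 15 / 2 * δ + 21 / 2 * κ + ε₁ ≤ min (3 * η / 4) (1 / 6) / 2)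
    {S Y N M ξ : ℝ} (hSx : x ^ (1 / 4 : ℝ) ≤ S) (hSx' : S ≤ x ^ (1 / 2 + δ)) (hN1 : 1 ≤ N)
    (hNS : N ≤ S ^ (2 / 3 - η)) (hY : 0 < Y) (hYS : Y ≤ S / 4) (hM : 0 ≤ M) (hξ : 0 ≤ ξ)
    {a₁ a₂ : ℤ} (ha₂ : a₂ ≠ 0) {q₀ n₀ : ℕ} (hq₀ : 0 < q₀) (hn₀ : 0 < n₀)
    (hq₀n₀ : Nat.Coprime q₀ n₀) (hq₀a₂ : IsCoprime (q₀ : ℤ) a₂)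
    {l₁ l₂ : ℕ} (hl₁ : Nat.Coprime l₁ (a₂.natAbs * n₀)) (hl₂ : Nat.Coprime l₂ (a₂.natAbs * n₀))
    (hl₁lt : l₁ < a₂.natAbs * n₀) (hl₂lt : l₂ < a₂.natAbs * n₀)
    {δ₁ δ₂ : ℕ} (hδ₁ : 0 < δ₁) (hδ₂ : 0 < δ₂) (hδ₁m : Nat.Coprime δ₁ (a₂.natAbs * n₀))
    (hδ₂m : Nat.Coprime δ₂ (a₂.natAbs * n₀))
    (hδ₁x : (δ₁ : ℝ) ≤ x ^ δ) (hδ₂x : (δ₂ : ℝ) ≤ x ^ δ) (ha₂x : (a₂.natAbs : ℝ) ≤ x ^ δ)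
    (hq : ((a₂.natAbs * n₀ : ℕ) : ℝ) ≤ x ^ θ) (hn₀N : (n₀ : ℝ) ≤ N)
    {β : ℕ → ℂ} (hβ : ∀ n, ¬Squarefree n → β n = 0) {Bβ : ℝ} (hB0 : 0 ≤ Bβ)
    (hβb : ∀ n, ‖β n‖ ≤ Bβ) (H k : ℕ) (hHr : (H : ℝ) ≤ 9 * S ^ 2 * N * x ^ ε₁ / x + 1)
    (hk : ((2 ^ (k + 1) : ℕ) : ℝ) ≤ 4 * x ^ δ * H * N + 2)
    (hC1 : (1 : ℝ) ≤ 29 / 40 * S / ((q₀ : ℝ) * δ₂)) (hD1 : (1 : ℝ) ≤ 29 / 40 * S / ((q₀ : ℝ) * δ₁))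
    {ε₀ Λ : ℝ} (hε₀ : 0 ≤ ε₀) (hε₀1 : ε₀ ≤ 1) (hΛ : 0 ≤ Λ)
    (hΛt : ∀ t : ℝ, (S - Y) / ((q₀ : ℝ) * ((δ₁ : ℝ) * δ₂)) ≤ t →
      (2 * S + Y) / Y + 29 + 3 ≤ Λ * t ^ ε₀)
    {A : ℝ} (hA : 0 ≤ A)
    (hcrux : (∀ C D N R S : ℝ, 1 ≤ C → 1 ≤ D → 1 ≤ N → 1 ≤ R → 1 ≤ S →
      ∀ q c₀ d₀ : ℕ, 0 < q → Nat.Coprime (c₀ * d₀) q →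
      ∀ b : ℕ → ℕ → ℕ → ℂ,
        (∀ n r s : ℕ, b n r s ≠ 0 →
          (0 < n ∧ (n : ℝ) ≤ N ∧ R < r ∧ (r : ℝ) ≤ 2 * R ∧ S < s ∧ (s : ℝ) ≤ 2 * S)) →
      ∀ g : ℝ → ℝ → ℝ → ℝ → ℝ → ℂ,
        ContDiff ℝ (⊤ : ℕ∞) (fun p : Fin 5 → ℝ => g (p 0) (p 1) (p 2) (p 3) (p 4)) →
        HasCompactSupport (fun p : Fin 5 → ℝ => g (p 0) (p 1) (p 2) (p 3) (p 4)) →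
        (∀ c d n r s : ℝ, g c d n r s ≠ 0 →
          (C < c ∧ c ≤ 2 * C ∧ D < d ∧ d ≤ 2 * D ∧ 0 < n ∧ 0 < r ∧ 0 < s)) →
        (∀ ν : Fin 5 → ℕ, ∀ c d n r s : ℝ, 0 < c → 0 < d → 0 < n → 0 < r → 0 < s →
          ‖mixedDeriv ν g c d n r s‖ ≤ KnuFamily Λ ν *
            (c ^ (-(ν 0 : ℝ)) * d ^ (-(ν 1 : ℝ)) * n ^ (-(ν 2 : ℝ)) * r ^ (-(ν 3 : ℝ)) *
              s ^ (-(ν 4 : ℝ))) ^ (1 - ε₀)) →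
        ‖∑ c ∈ Finset.Icc 1 ⌊2 * C⌋₊, ∑ d ∈ Finset.Icc 1 ⌊2 * D⌋₊, ∑ n ∈ Finset.Icc 1 ⌊N⌋₊, ∑ r ∈ Finset.Icc 1 ⌊2 * R⌋₊,
            ∑ s ∈ Finset.Icc 1 ⌊2 * S⌋₊,
            (if (c ≡ c₀ [MOD q] ∧ d ≡ d₀ [MOD q] ∧ Nat.Coprime (q * r * d) (s * c)) then
              b n r s * g c d n r s *
                (𝐞 ((n : ℝ) * ((((r * d : ℕ) : ZMod (s * c))⁻¹).val : ℝ) / ((s : ℝ) * c)) : ℂ)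
            else 0)‖ ≤
          A * ((q : ℝ) * C * D * N * R * S) ^ e * (q : ℝ) ^ (3 / 2 : ℝ) *
            Real.sqrt
              ((q : ℝ) ^ 2 * (C * S * (R * S + N) * (C + R * D) + S * N * R) *
                  (∑ n ∈ Finset.Icc 1 ⌊N⌋₊, ∑ r ∈ Finset.Icc 1 ⌊2 * R⌋₊, ∑ s ∈ Finset.Icc 1 ⌊2 * S⌋₊, ‖b n r s‖ ^ 2) +
                (q : ℝ) * (C ^ 2 * D * S * Real.sqrt (R * (R * S + N)) + D ^ 2 * N * R) *
                  (∑ n ∈ Finset.Icc 1 ⌊N⌋₊, ∑ r ∈ Finset.Icc 1 ⌊2 * R⌋₊, ∑ s ∈ Finset.Icc 1 ⌊2 * S⌋₊, ‖b n r s‖ ^ 2)))) :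
    ‖pieceSumBlk a₁ a₂ (((((((BFI.mRange S Y).filter (fun q : ℕ => 0 < q)).filter (fun q : ℕ => IsCoprime (q : ℤ) a₂)).filter (fun q : ℕ => q₀ ∣ q)).image (fun q : ℕ => q / q₀)).filter (fun q : ℕ => q % (a₂.natAbs * n₀) = l₁)).filter (fun q : ℕ => δ₁ ∣ q))
        (((((((BFI.mRange S Y).filter (fun q : ℕ => 0 < q)).filter (fun q : ℕ => IsCoprime (q : ℤ) a₂)).filter (fun q : ℕ => q₀ ∣ q)).image (fun q : ℕ => q / q₀)).filter (fun q : ℕ => q % (a₂.natAbs * n₀) = l₂)).filter (fun q : ℕ => δ₂ ∣ q)) ((((BFI.dyadic N).filter (fun n : ℕ => IsCoprime (n : ℤ) a₂)).filter (fun n : ℕ => n₀ ∣ n)).image (fun n : ℕ => n / n₀))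
        q₀ n₀ l₁ l₂ β ξ (fun q₁ q₂ : ℕ => pieceLo S Y q₀ q₁ * pieceLo S Y q₀ q₂ *
          alphaProfile ((q₀ : ℝ) * ξ / M * q₁ * q₂)) H (-1) (2 ^ k) (2 ^ (k + 1))‖ +
      ‖pieceSumBlk a₁ a₂ (((((((BFI.mRange S Y).filter (fun q : ℕ => 0 < q)).filter (fun q : ℕ => IsCoprime (q : ℤ) a₂)).filter (fun q : ℕ => q₀ ∣ q)).image (fun q : ℕ => q / q₀)).filter (fun q : ℕ => q % (a₂.natAbs * n₀) = l₁)).filter (fun q : ℕ => δ₁ ∣ q))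
        (((((((BFI.mRange S Y).filter (fun q : ℕ => 0 < q)).filter (fun q : ℕ => IsCoprime (q : ℤ) a₂)).filter (fun q : ℕ => q₀ ∣ q)).image (fun q : ℕ => q / q₀)).filter (fun q : ℕ => q % (a₂.natAbs * n₀) = l₂)).filter (fun q : ℕ => δ₂ ∣ q)) ((((BFI.dyadic N).filter (fun n : ℕ => IsCoprime (n : ℤ) a₂)).filter (fun n : ℕ => n₀ ∣ n)).image (fun n : ℕ => n / n₀))
        q₀ n₀ l₁ l₂ β ξ (fun q₁ q₂ : ℕ => pieceLo S Y q₀ q₁ * pieceHi S Y q₀ q₂ *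
          alphaProfile ((q₀ : ℝ) * ξ / M * q₁ * q₂)) H (-1) (2 ^ k) (2 ^ (k + 1))‖ +
      ‖pieceSumBlk a₁ a₂ (((((((BFI.mRange S Y).filter (fun q : ℕ => 0 < q)).filter (fun q : ℕ => IsCoprime (q : ℤ) a₂)).filter (fun q : ℕ => q₀ ∣ q)).image (fun q : ℕ => q / q₀)).filter (fun q : ℕ => q % (a₂.natAbs * n₀) = l₁)).filter (fun q : ℕ => δ₁ ∣ q))
        (((((((BFI.mRange S Y).filter (fun q : ℕ => 0 < q)).filter (fun q : ℕ => IsCoprime (q : ℤ) a₂)).filter (fun q : ℕ => q₀ ∣ q)).image (fun q : ℕ => q / q₀)).filter (fun q : ℕ => q % (a₂.natAbs * n₀) = l₂)).filter (fun q : ℕ => δ₂ ∣ q)) ((((BFI.dyadic N).filter (fun n : ℕ => IsCoprime (n : ℤ) a₂)).filter (fun n : ℕ => n₀ ∣ n)).image (fun n : ℕ => n / n₀))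
        q₀ n₀ l₁ l₂ β ξ (fun q₁ q₂ : ℕ => pieceHi S Y q₀ q₁ * pieceLo S Y q₀ q₂ *
          alphaProfile ((q₀ : ℝ) * ξ / M * q₁ * q₂)) H (-1) (2 ^ k) (2 ^ (k + 1))‖ +
      ‖pieceSumBlk a₁ a₂ (((((((BFI.mRange S Y).filter (fun q : ℕ => 0 < q)).filter (fun q : ℕ => IsCoprime (q : ℤ) a₂)).filter (fun q : ℕ => q₀ ∣ q)).image (fun q : ℕ => q / q₀)).filter (fun q : ℕ => q % (a₂.natAbs * n₀) = l₁)).filter (fun q : ℕ => δ₁ ∣ q))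
        (((((((BFI.mRange S Y).filter (fun q : ℕ => 0 < q)).filter (fun q : ℕ => IsCoprime (q : ℤ) a₂)).filter (fun q : ℕ => q₀ ∣ q)).image (fun q : ℕ => q / q₀)).filter (fun q : ℕ => q % (a₂.natAbs * n₀) = l₂)).filter (fun q : ℕ => δ₂ ∣ q)) ((((BFI.dyadic N).filter (fun n : ℕ => IsCoprime (n : ℤ) a₂)).filter (fun n : ℕ => n₀ ∣ n)).image (fun n : ℕ => n / n₀))
        q₀ n₀ l₁ l₂ β ξ (fun q₁ q₂ : ℕ => pieceHi S Y q₀ q₁ * pieceHi S Y q₀ q₂ *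
          alphaProfile ((q₀ : ℝ) * ξ / M * q₁ * q₂)) H (-1) (2 ^ k) (2 ^ (k + 1))‖ ≤
      4 * (169632 * A * (Real.sqrt (9 / 5) * Bβ ^ 2) * N ^ 2 * S ^ 2 * x ^ (-8 * κ)) := by
  have hx0 : 0 < x := by linarith
  have hN : 0 < N := by linarith
  have hS : 0 < S := by linarith
  have hq₀r : (0 : ℝ) < q₀ := by exact_mod_cast hq₀
  have hn₀r : (0 : ℝ) < n₀ := by exact_mod_cast hn₀
  have hδ₁r : (0 : ℝ) < δ₁ := by exact_mod_cast hδ₁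
  have hδ₂r : (0 : ℝ) < δ₂ := by exact_mod_cast hδ₂
  have har : (0 : ℝ) < a₂.natAbs := by exact_mod_cast Int.natAbs_pos.2 ha₂
  have hm : 0 < a₂.natAbs * n₀ := Nat.mul_pos (Int.natAbs_pos.2 ha₂) hn₀
  -- the numerical hypotheses of `cruxRHS_le`
  have hq1 : (1 : ℝ) ≤ ((a₂.natAbs * n₀ : ℕ) : ℝ) := by exact_mod_cast hm
  have hq₀δ₂ : (1 : ℝ) ≤ (q₀ : ℝ) * δ₂ := by
    have : (1 : ℕ) ≤ q₀ * δ₂ := Nat.mul_pos hq₀ hδ₂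
    exact_mod_cast this
  have hq₀δ₁ : (1 : ℝ) ≤ (q₀ : ℝ) * δ₁ := by
    have : (1 : ℕ) ≤ q₀ * δ₁ := Nat.mul_pos hq₀ hδ₁
    exact_mod_cast this
  have hCle : ∀ (cst : ℝ) (u : ℝ), 0 ≤ cst → cst ≤ 2 → 1 ≤ u → cst * S / u ≤ 2 * S := by
    intro cst u h0 h2 hu
    rw [div_le_iff₀ (by linarith)]
    nlinarith [hS.le]
  have hCLo2 : 29 / 40 * S / ((q₀ : ℝ) * δ₂) ≤ 2 * S := hCle _ _ (by norm_num) (by norm_num) hq₀δ₂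
  have hCHi2 : 9 / 8 * S / ((q₀ : ℝ) * δ₂) ≤ 2 * S := hCle _ _ (by norm_num) (by norm_num) hq₀δ₂
  have hDLo2 : 29 / 40 * S / ((q₀ : ℝ) * δ₁) ≤ 2 * S := hCle _ _ (by norm_num) (by norm_num) hq₀δ₁
  have hDHi2 : 9 / 8 * S / ((q₀ : ℝ) * δ₁) ≤ 2 * S := hCle _ _ (by norm_num) (by norm_num) hq₀δ₁
  have hC1' : (1 : ℝ) ≤ 9 / 8 * S / ((q₀ : ℝ) * δ₂) :=
    hC1.trans (by rw [div_le_div_iff_of_pos_right (by positivity)]; nlinarith [hS.le])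
  have hD1' : (1 : ℝ) ≤ 9 / 8 * S / ((q₀ : ℝ) * δ₁) :=
    hD1.trans (by rw [div_le_div_iff_of_pos_right (by positivity)]; nlinarith [hS.le])
  have hR1 : (1 : ℝ) ≤ (a₂.natAbs : ℝ) * δ₁ * N := by
    have h1 : (1 : ℝ) ≤ (a₂.natAbs : ℝ) := by exact_mod_cast Int.natAbs_pos.2 ha₂
    have h2 : (1 : ℝ) ≤ (δ₁ : ℝ) := by exact_mod_cast hδ₁
    nlinarith [mul_nonneg (sub_nonneg.2 h1) (sub_nonneg.2 h2), mul_nonneg (mul_nonneg har.le hδ₁r.le) (sub_nonneg.2 hN1)]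
  have hS1 : (1 : ℝ) ≤ (δ₂ : ℝ) * N / n₀ := by
    rw [le_div_iff₀ hn₀r]
    have h2 : (1 : ℝ) ≤ (δ₂ : ℝ) := by exact_mod_cast hδ₂
    nlinarith
  have hRx : (a₂.natAbs : ℝ) * δ₁ * N ≤ x ^ (2 * δ) * N := by
    have : x ^ (2 * δ) = x ^ δ * x ^ δ := by rw [← Real.rpow_add hx0]; ring_nf
    rw [this]; gcongr
  have hSx1 : (δ₂ : ℝ) * N / n₀ ≤ x ^ δ * N := by
    rw [div_le_iff₀ hn₀r]
    have h1 : (1 : ℝ) ≤ n₀ := by exact_mod_cast hn₀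
    have h2 : (δ₂ : ℝ) * N ≤ x ^ δ * N := by gcongr
    nlinarith [mul_nonneg (Real.rpow_nonneg hx0.le δ) hN.le]
  have hSb := Sb_le_neg (a₁ := a₁) (l₁ := l₁) (l₂ := l₂) (ξ := ξ) (q₀ := q₀) hN1 ha₂ hn₀ hδ₁ hδ₂ hB0 hβb H k
  have hW0 : 0 ≤ Real.sqrt (9 / 5) * Bβ ^ 2 := by positivity
  have hNb0 : (0 : ℝ) ≤ ((2 ^ (k + 1) : ℕ) : ℝ) := by positivity
  -- the four pieces
  have eLL := (blk_le_crux_LL_neg hY hYS hN hM hξ ha₂ hq₀ hn₀ hq₀n₀ hq₀a₂ hl₁ hl₂ hl₁lt hl₂lt hδ₁ hδ₂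
    hδ₁m hδ₂m hβ H k hC1 hD1 hR1 hS1 hε₀ hε₀1 hΛ hΛt hcrux).trans
    (cruxRHS_le hx hη hη' hδ hκ hε₁ he he1 hθ hδs hκs hε₁s hexp hSx hSx' hN1 hNS hHr hq1 hq
      (by positivity) hCLo2 (by positivity) hDLo2 hNb0 hk (by positivity) hRx (by positivity) hSx1
      (by positivity) hSb hW0 hA)
  have eLH := (blk_le_crux_LH_neg hY hYS hN hM hξ ha₂ hq₀ hn₀ hq₀n₀ hq₀a₂ hl₁ hl₂ hl₁lt hl₂lt hδ₁ hδ₂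
    hδ₁m hδ₂m hβ H k hC1' hD1 hR1 hS1 hε₀ hε₀1 hΛ hΛt hcrux).trans
    (cruxRHS_le hx hη hη' hδ hκ hε₁ he he1 hθ hδs hκs hε₁s hexp hSx hSx' hN1 hNS hHr hq1 hq
      (by positivity) hCHi2 (by positivity) hDLo2 hNb0 hk (by positivity) hRx (by positivity) hSx1
      (by positivity) hSb hW0 hA)
  have eHL := (blk_le_crux_HL_neg hY hYS hN hM hξ ha₂ hq₀ hn₀ hq₀n₀ hq₀a₂ hl₁ hl₂ hl₁lt hl₂lt hδ₁ hδ₂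
    hδ₁m hδ₂m hβ H k hC1 hD1' hR1 hS1 hε₀ hε₀1 hΛ hΛt hcrux).trans
    (cruxRHS_le hx hη hη' hδ hκ hε₁ he he1 hθ hδs hκs hε₁s hexp hSx hSx' hN1 hNS hHr hq1 hq
      (by positivity) hCLo2 (by positivity) hDHi2 hNb0 hk (by positivity) hRx (by positivity) hSx1
      (by positivity) hSb hW0 hA)
  have eHH := (blk_le_crux_HH_neg hY hYS hN hM hξ ha₂ hq₀ hn₀ hq₀n₀ hq₀a₂ hl₁ hl₂ hl₁lt hl₂lt hδ₁ hδ₂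
    hδ₁m hδ₂m hβ H k hC1' hD1' hR1 hS1 hε₀ hε₀1 hΛ hΛt hcrux).trans
    (cruxRHS_le hx hη hη' hδ hκ hε₁ he he1 hθ hδs hκs hε₁s hexp hSx hSx' hN1 hNS hHr hq1 hq
      (by positivity) hCHi2 (by positivity) hDHi2 hNb0 hk (by positivity) hRx (by positivity) hSx1
      (by positivity) hSb hW0 hA)
  have hsum := add_le_add (add_le_add (add_le_add eLL eLH) eHL) eHH
  linarith only [hsum]

end Drappeau2017

end Literature.NumberTheory.Sieve

end
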